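import Mathlib
import Summits.ValiantsHypothesis.ValiantsHypothesis.Theorems.LacunarySymmetroidMatrixDescartesMonotoneIncoherence
import Summits.ValiantsHypothesis.ValiantsHypothesis.Theorems.LacunarySymmetroidMatrixDescartesGramDualPencil

/-!
# `MatrixDescartes` (stmt-ValiantsHypothesis-18050) — THE MONOTONE INCOHERENCE LAW IN THE CRUX'S CURRENCY: a pencil
# `Σ_l X^{d_l} S_l` with a non-degenerate letter `S_{l₀}`, PSD letters above it and NSD letters below it, has at most
# `Σ_{l ∉ core} rank S_l` positive zeros (with multiplicity), for ANY sub-family `core` of letters whose joint ranges are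
# `S_{l₀}⁻¹`-coherent — at every size and for all exponents

HONEST FRAMING.  Cell `pub-symmetroid`, seat `val-sym-mdr-p2` (gen 20); helper file `--supports` the crux
`Theses.LacunarySymmetroid.MatrixDescartes` (OPEN), NO closure claim; the pencil-currency form of `…MonotoneIncoherence`
(`GramDual.card_posRoots_multiset_le_of_monotone`, column currency) through the signed column form of `…GramDualPencil`.
A SECTOR law refining the one-sided rung `Z₊ ≤ m`; nothing here bears on the crux in its window, `stub_twoSided`,
`DoorA26` / `DoorA34`, registers, or `VP ≠ VNP`.

THE SECTOR.  Real symmetric letters, `det S_{l₀} ≠ 0`; every other letter is PSD with exponent `> d_{l₀}` or NSD with exponent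
`< d_{l₀}` (so `x^{−d_{l₀}}F(x)` is Loewner-increasing; the tree's one-sided rung is «all PSD above»).  `core` is any set of
letters; COHERENCE of the core: `S_{l₀}⁻¹ ⪰ 0` on the joint range of the PSD core letters and `⪯ 0` on the joint range of the NSD
core letters (no condition between the two, none on the other letters).

* `signedPart_reindex`, `submatrix_sumCompl_eq_fromCols` — splitting a signed column system along a predicate on the columns is
  a juxtaposition `fromCols` (bookkeeping for `…MonotoneIncoherence`).
* `card_cols_not_core_eq_sum_rank` — the number of eigen-columns of the letters outside the core is `Σ_{l≠l₀, l∉core} rank S_l`.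
* **`monotone_pencil_card_posRoots_multiset_le` (THE LAW).**  On the sector, the positive zeros of `det(Σ_l X^{d_l} S_l)` counted
  WITH MULTIPLICITY number at most `Σ_{l ≠ l₀, l ∉ core} rank S_l`; `monotone_pencil_card_posRoots_le` for distinct zeros.
  With `core = ∅` this is `Z₊ ≤ Σ_{l≠l₀} rank S_l`; with all letters in a coherent core it is the sterile law; the content is in
  between: ONLY THE LETTERS OUTSIDE A COHERENT CORE ARE CHARGED, and only by their ranks — e.g. PSD letters above an indefinite
  non-degenerate `S_{l₀}` whose joint range is `S_{l₀}⁻¹`-nonnegative except for one rank-one letter ⇒ at most ONE positive zero,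
  whatever `m`, `K` and the exponents.

[folklore] (Sylvester's law of inertia along a monotone family; Haynsworth; spectral theorem).  Axioms `propext`,
`Classical.choice`, `Quot.sound`.
-/

-- layout Summits/ValiantsHypothesis/ValiantsHypothesis forces the duplicated namespace component
set_option linter.dupNamespace false

namespace Summit.ValiantsHypothesis.ValiantsHypothesis.Theorems.LacunarySymmetroidMatrixDescartes

open Polynomial Matrix Finset
open scoped BigOperators

namespace GramDual

/-- the signed column part (file-local notation, as in `…GramDualSigned`) -/
local notation3 (prettyPrint := false) "𝕊[" U ", " σ ", " δ "]" =>
  ((U : Matrix _ _ ℝ).map Polynomial.C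
      * Matrix.diagonal (fun j => Polynomial.C ((σ : _ → ℝ) j) * (Polynomial.X : Polynomial ℝ) ^ (δ j : ℕ))
      * ((U : Matrix _ _ ℝ).map Polynomial.C)ᵀ)

/-! ## §1  Splitting a column system along a predicate -/

section Split

variable {ι ρ α : Type} [Fintype ρ] [DecidableEq ρ] [Fintype α] [DecidableEq α]

/-- Re-indexing the columns along an equivalence does not change the signed column part. [folklore] -/
theorem signedPart_reindex (U : Matrix ι ρ ℝ) (σ : ρ → ℝ) (δ : ρ → ℕ) (e : α ≃ ρ) :
    𝕊[(U.submatrix id e), (σ ∘ e), (δ ∘ e)] = 𝕊[U, σ, δ] := by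
  refine Matrix.ext fun a b => ?_
  rw [signedPart_apply, signedPart_apply]
  exact e.sum_comp (fun t => (Polynomial.X : Polynomial ℝ) ^ δ t * Polynomial.C (U a t * σ t * U b t))

omit [Fintype ρ] [DecidableEq ρ] in
/-- Splitting the columns along a predicate is a juxtaposition. [folklore] -/
theorem submatrix_sumCompl_eq_fromCols (U : Matrix ι ρ ℝ) (q : ρ → Prop) [DecidablePred q] :
    U.submatrix id (Equiv.sumCompl q)
      = Matrix.fromCols (Matrix.of fun a (t : {t // q t}) => U a t.1) (Matrix.of fun a (t : {t // ¬ q t}) => U a t.1) := by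
  refine Matrix.ext fun a t => ?_
  cases t with
  | inl t => rw [Matrix.submatrix_apply, Matrix.fromCols_apply_inl, Matrix.of_apply, id, Equiv.sumCompl_apply_inl]
  | inr t => rw [Matrix.submatrix_apply, Matrix.fromCols_apply_inr, Matrix.of_apply, id, Equiv.sumCompl_apply_inr]

omit [Fintype ρ] [DecidableEq ρ] in
/-- Splitting a function on the columns along a predicate. [folklore] -/
theorem comp_sumCompl_eq_sum_elim {β : Type} (f : ρ → β) (q : ρ → Prop) [DecidablePred q] :
    f ∘ (Equiv.sumCompl q) = Sum.elim (fun t : {t // q t} => f t.1) (fun t : {t // ¬ q t} => f t.1) := by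
  funext t
  cases t with
  | inl t => rw [Function.comp_apply, Equiv.sumCompl_apply_inl, Sum.elim_inl]
  | inr t => rw [Function.comp_apply, Equiv.sumCompl_apply_inr, Sum.elim_inr]

omit [DecidableEq ρ] in
/-- The sub-system on `{q}` applied to `v` is the full system applied to `v` extended by zero. [folklore] -/
theorem subCols_mulVec_eq [Fintype ι] (U : Matrix ι ρ ℝ) (q : ρ → Prop) [DecidablePred q] (v : {t // q t} → ℝ) :
    (Matrix.of fun a (t : {t // q t}) => U a t.1) *ᵥ v = U *ᵥ (fun t => if h : q t then v ⟨t, h⟩ else 0) := by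
  classical
  funext a
  simp only [Matrix.mulVec, dotProduct, Matrix.of_apply]
  rw [← Fintype.sum_subtype_add_sum_subtype q (fun t => U a t * (if h : q t then v ⟨t, h⟩ else 0))]
  have h1 : ∑ t : {t // q t}, U a t.1 * (if h : q t.1 then v ⟨t.1, h⟩ else 0) = ∑ t : {t // q t}, U a t.1 * v t := by
    refine Finset.sum_congr rfl fun t _ => ?_
    rw [dif_pos t.2]
  have h2 : ∑ t : {t // ¬ q t}, U a t.1 * (if h : q t.1 then v ⟨t.1, h⟩ else 0) = 0 := by
    refine Finset.sum_eq_zero fun t _ => ?_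
    rw [dif_neg t.2, mul_zero]
  rw [h1, h2, add_zero]

end Split

/-! ## §2  The law in the crux's currency -/

section Pencil

variable {K m : ℕ}

/-- **The number of eigen-columns of the letters outside the core** is `Σ_{l ≠ l₀, l ∉ core} rank S_l`. [folklore] -/
theorem card_cols_not_core_eq_sum_rank (S : Fin K → Matrix (Fin m) (Fin m) ℝ) (hS : ∀ l, (S l).IsHermitian) (l₀ : Fin K)
    (core : Fin K → Prop) [DecidablePred core] :
    Fintype.card {t : {li : Fin K × Fin m // li.1 ≠ l₀ ∧ (hS li.1).eigenvalues li.2 ≠ 0} // ¬ core t.1.1}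
      = ∑ l ∈ Finset.univ.filter (fun l => l ≠ l₀ ∧ ¬ core l), (S l).rank := by
  classical
  rw [Fintype.card_congr (Equiv.subtypeSubtypeEquivSubtypeInter
    (fun li : Fin K × Fin m => li.1 ≠ l₀ ∧ (hS li.1).eigenvalues li.2 ≠ 0) (fun li => ¬ core li.1)), Fintype.card_subtype]
  have h : (Finset.univ.filter fun li : Fin K × Fin m =>
        (li.1 ≠ l₀ ∧ (hS li.1).eigenvalues li.2 ≠ 0) ∧ ¬ core li.1)
      = (Finset.univ.filter fun l => l ≠ l₀ ∧ ¬ core l).biUnion fun l =>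
          (Finset.univ.filter fun i : Fin m => (hS l).eigenvalues i ≠ 0).map ⟨fun i => (l, i), fun i j h => by
            simpa using h⟩ := by
    ext ⟨l, i⟩
    simp only [Finset.mem_filter, Finset.mem_univ, true_and, Finset.mem_biUnion, Finset.mem_map,
      Function.Embedding.coeFn_mk, Prod.mk.injEq, ne_eq]
    constructor
    · rintro ⟨⟨hl, hi⟩, hc⟩
      exact ⟨l, ⟨hl, hc⟩, i, hi, rfl, rfl⟩
    · rintro ⟨l', ⟨hl', hc'⟩, i', hi', rfl, rfl⟩
      exact ⟨⟨hl', hi'⟩, hc'⟩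
  rw [h, Finset.card_biUnion]
  · refine Finset.sum_congr rfl fun l _ => ?_
    rw [Finset.card_map, (hS l).rank_eq_card_non_zero_eigs, Fintype.card_subtype]
  · intro l _ l' _ hll'
    rw [Function.onFun, Finset.disjoint_left]
    intro x hx hx'
    simp only [Finset.mem_map, Finset.mem_filter, Finset.mem_univ, true_and, Function.Embedding.coeFn_mk] at hx hx'
    obtain ⟨i, -, rfl⟩ := hx
    obtain ⟨i', -, h⟩ := hx'
    exact hll' (Prod.mk.inj h).1.symm

/-- **THE MONOTONE INCOHERENCE LAW IN THE CRUX'S CURRENCY (with multiplicity).**  Real symmetric letters, `det S_{l₀} ≠ 0`,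
every other letter PSD above `d_{l₀}` or NSD below `d_{l₀}`; `core` any set of letters with `S_{l₀}⁻¹ ⪰ 0` on the joint range of
its PSD letters and `⪯ 0` on the joint range of its NSD letters.  Then the positive zeros of `det(Σ_l X^{d_l} S_l)` counted with
multiplicity number at most `Σ_{l ≠ l₀, l ∉ core} rank S_l`. [folklore] -/
theorem monotone_pencil_card_posRoots_multiset_le (d : Fin K → ℕ) (S : Fin K → Matrix (Fin m) (Fin m) ℝ)
    (hS : ∀ l, (S l).IsSymm) (l₀ : Fin K) (hS₀ : IsUnit (S l₀).det) (core : Fin K → Prop) [DecidablePred core]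
    (hmono : ∀ l, l ≠ l₀ → ((S l).PosSemidef ∧ d l₀ < d l) ∨ ((-(S l)).PosSemidef ∧ d l < d l₀))
    (hP : ∀ w : Fin K → Fin m → ℝ, w l₀ = 0 → (∀ l, w l ≠ 0 → core l ∧ (S l).PosSemidef) →
        0 ≤ (∑ l, S l *ᵥ w l) ⬝ᵥ ((S l₀)⁻¹ *ᵥ ∑ l, S l *ᵥ w l))
    (hN : ∀ w : Fin K → Fin m → ℝ, w l₀ = 0 → (∀ l, w l ≠ 0 → core l ∧ (-(S l)).PosSemidef) →
        (∑ l, S l *ᵥ w l) ⬝ᵥ ((S l₀)⁻¹ *ᵥ ∑ l, S l *ᵥ w l) ≤ 0) :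
    Multiset.card ((Matrix.det (∑ l, ((Polynomial.X : Polynomial ℝ) ^ d l) • (S l).map Polynomial.C)).roots.filter
        (fun t => 0 < t))
      ≤ ∑ l ∈ Finset.univ.filter (fun l => l ≠ l₀ ∧ ¬ core l), (S l).rank := by
  classical
  have hH : ∀ l, (S l).IsHermitian := fun l => isHermitian_of_isSymm_real (hS l)
  -- signed column form, columns `T`, split along `q t := core t.1.1`
  rw [pencil_eq_base_add_signedPart d S hH l₀]
  set U : Matrix (Fin m) {li : Fin K × Fin m // li.1 ≠ l₀ ∧ (hH li.1).eigenvalues li.2 ≠ 0} ℝ :=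
    Matrix.of fun (a : Fin m) (t : {li : Fin K × Fin m // li.1 ≠ l₀ ∧ (hH li.1).eigenvalues li.2 ≠ 0}) =>
      ((hH t.1.1).eigenvectorUnitary : Matrix (Fin m) (Fin m) ℝ) a t.1.2 with hU
  set σ : {li : Fin K × Fin m // li.1 ≠ l₀ ∧ (hH li.1).eigenvalues li.2 ≠ 0} → ℝ := fun t => (hH t.1.1).eigenvalues t.1.2
    with hσ
  set δ : {li : Fin K × Fin m // li.1 ≠ l₀ ∧ (hH li.1).eigenvalues li.2 ≠ 0} → ℕ := fun t => d t.1.1 with hδ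
  set q : {li : Fin K × Fin m // li.1 ≠ l₀ ∧ (hH li.1).eigenvalues li.2 ≠ 0} → Prop := fun t => core t.1.1 with hq
  have hsplit : 𝕊[U, σ, δ]
      = 𝕊[(Matrix.of fun a (t : {t // q t}) => U a t.1), (fun t : {t // q t} => σ t.1), (fun t : {t // q t} => δ t.1)]
        + 𝕊[(Matrix.of fun a (t : {t // ¬ q t}) => U a t.1), (fun t : {t // ¬ q t} => σ t.1), (fun t : {t // ¬ q t} => δ t.1)] := by
    rw [← signedPart_reindex U σ δ (Equiv.sumCompl q), submatrix_sumCompl_eq_fromCols, comp_sumCompl_eq_sum_elim,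
      comp_sumCompl_eq_sum_elim, signedPart_fromCols]
  -- the sign/exponent facts on the columns
  have hsign : ∀ t : {li : Fin K × Fin m // li.1 ≠ l₀ ∧ (hH li.1).eigenvalues li.2 ≠ 0},
      (0 < σ t ∧ d l₀ < δ t ∧ (S t.1.1).PosSemidef) ∨ (σ t < 0 ∧ δ t < d l₀ ∧ (-(S t.1.1)).PosSemidef) := by
    intro t
    rcases hmono t.1.1 t.2.1 with ⟨hpsd, hd⟩ | ⟨hnsd, hd⟩
    · exact Or.inl ⟨lt_of_le_of_ne (eigenvalues_nonneg_of_posSemidef' (hH t.1.1) hpsd t.1.2) (Ne.symm t.2.2), hd, hpsd⟩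
    · exact Or.inr ⟨lt_of_le_of_ne (eigenvalues_nonpos_of_neg_posSemidef (hH t.1.1) hnsd t.1.2) t.2.2, hd, hnsd⟩
  have hmonoT : ∀ t : {li : Fin K × Fin m // li.1 ≠ l₀ ∧ (hH li.1).eigenvalues li.2 ≠ 0},
      (0 < σ t ∧ d l₀ < δ t) ∨ (σ t < 0 ∧ δ t < d l₀) := fun t => by
    rcases hsign t with ⟨h1, h2, -⟩ | ⟨h1, h2, -⟩
    · exact Or.inl ⟨h1, h2⟩
    · exact Or.inr ⟨h1, h2⟩
  -- the Gram form of the core sub-system through the joint range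
  have hgram : ∀ v : {t // q t} → ℝ,
      v ⬝ᵥ (((Matrix.of fun a (t : {t // q t}) => U a t.1)ᵀ * (S l₀)⁻¹ * (Matrix.of fun a (t : {t // q t}) => U a t.1)) *ᵥ v)
        = (U *ᵥ (fun t => if h : q t then v ⟨t, h⟩ else 0))
          ⬝ᵥ ((S l₀)⁻¹ *ᵥ (U *ᵥ (fun t => if h : q t then v ⟨t, h⟩ else 0))) := by
    intro v
    rw [← form_conj, subCols_mulVec_eq]
  have hrange : ∀ v : {t // q t} → ℝ, ∃ w : Fin K → Fin m → ℝ, w l₀ = 0 ∧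
      (∀ l, w l ≠ 0 → core l ∧ ∃ i, ∃ h : l ≠ l₀ ∧ (hH l).eigenvalues i ≠ 0, ∃ hq : q ⟨(l, i), h⟩, v ⟨⟨(l, i), h⟩, hq⟩ ≠ 0) ∧
      U *ᵥ (fun t => if h : q t then v ⟨t, h⟩ else 0) = ∑ l, S l *ᵥ w l := by
    intro v
    obtain ⟨w, hw0, hwsupp, hUv⟩ := exists_rangeVector S hH l₀ (fun t => if h : q t then v ⟨t, h⟩ else 0)
    refine ⟨w, hw0, fun l hl => ?_, hUv⟩
    obtain ⟨i, h, hvi⟩ := hwsupp l hl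
    by_cases hqt : q ⟨(l, i), h⟩
    · rw [dif_pos hqt] at hvi
      exact ⟨hqt, i, h, hqt, hvi⟩
    · rw [dif_neg hqt] at hvi
      exact absurd rfl hvi
  -- apply the column-currency law
  rw [hsplit, ← add_assoc]
  beta_reduce
  have hmain := card_posRoots_multiset_le_of_monotone (S l₀) (hS l₀) hS₀
    (Matrix.of fun a (t : {t // q t}) => U a t.1) (Matrix.of fun a (t : {t // ¬ q t}) => U a t.1)
    (fun t : {t // q t} => σ t.1) (fun t : {t // ¬ q t} => σ t.1) (d l₀)
    (fun t : {t // q t} => δ t.1) (fun t : {t // ¬ q t} => δ t.1)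
    (fun t => hmonoT t.1) (fun t => hmonoT t.1) ?_ ?_
  · refine hmain.trans (le_of_eq ?_)
    exact card_cols_not_core_eq_sum_rank S hH l₀ core
  · -- positive core columns lie in the joint range of the PSD core letters
    intro v hv
    rw [hgram]
    obtain ⟨w, hw0, hwsupp, hUv⟩ := hrange v
    rw [hUv]
    refine hP w hw0 fun l hl => ?_
    obtain ⟨hc, i, h, hqt, hvi⟩ := hwsupp l hl
    refine ⟨hc, ?_⟩
    rcases hsign ⟨(l, i), h⟩ with ⟨-, -, hpsd⟩ | ⟨hneg, -, -⟩
    · exact hpsd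
    · exact absurd (hv ⟨⟨(l, i), h⟩, hqt⟩ hneg) hvi
  · -- negative core columns lie in the joint range of the NSD core letters
    intro v hv
    rw [hgram]
    obtain ⟨w, hw0, hwsupp, hUv⟩ := hrange v
    rw [hUv]
    refine hN w hw0 fun l hl => ?_
    obtain ⟨hc, i, h, hqt, hvi⟩ := hwsupp l hl
    refine ⟨hc, ?_⟩
    rcases hsign ⟨(l, i), h⟩ with ⟨hpos, -, -⟩ | ⟨-, -, hnsd⟩
    · exact absurd (hv ⟨⟨(l, i), h⟩, hqt⟩ hpos) hvi
    · exact hnsd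

/-- **THE MONOTONE INCOHERENCE LAW IN THE CRUX'S CURRENCY (distinct zeros)**: `Z₊ ≤ Σ_{l ≠ l₀, l ∉ core} rank S_l`.
[folklore] -/
theorem monotone_pencil_card_posRoots_le (d : Fin K → ℕ) (S : Fin K → Matrix (Fin m) (Fin m) ℝ)
    (hS : ∀ l, (S l).IsSymm) (l₀ : Fin K) (hS₀ : IsUnit (S l₀).det) (core : Fin K → Prop) [DecidablePred core]
    (hmono : ∀ l, l ≠ l₀ → ((S l).PosSemidef ∧ d l₀ < d l) ∨ ((-(S l)).PosSemidef ∧ d l < d l₀))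
    (hP : ∀ w : Fin K → Fin m → ℝ, w l₀ = 0 → (∀ l, w l ≠ 0 → core l ∧ (S l).PosSemidef) →
        0 ≤ (∑ l, S l *ᵥ w l) ⬝ᵥ ((S l₀)⁻¹ *ᵥ ∑ l, S l *ᵥ w l))
    (hN : ∀ w : Fin K → Fin m → ℝ, w l₀ = 0 → (∀ l, w l ≠ 0 → core l ∧ (-(S l)).PosSemidef) →
        (∑ l, S l *ᵥ w l) ⬝ᵥ ((S l₀)⁻¹ *ᵥ ∑ l, S l *ᵥ w l) ≤ 0) :
    ((Matrix.det (∑ l, ((Polynomial.X : Polynomial ℝ) ^ d l) • (S l).map Polynomial.C)).roots.toFinset.filter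
        (fun t => 0 < t)).card
      ≤ ∑ l ∈ Finset.univ.filter (fun l => l ≠ l₀ ∧ ¬ core l), (S l).rank := by
  classical
  refine le_trans ?_ (monotone_pencil_card_posRoots_multiset_le d S hS l₀ hS₀ core hmono hP hN)
  rw [← Multiset.toFinset_filter]
  exact Multiset.toFinset_card_le _

/-- **PSD letters above an indefinite base** (the one-sided rung's setting): `det S_{l₀} ≠ 0`, all other letters PSD with larger
exponents, `S_{l₀}⁻¹ ⪰ 0` on the joint range of the core letters ⇒ `Z₊ ≤ Σ_{l ≠ l₀, l ∉ core} rank S_l`. [folklore] -/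
theorem oneSided_pencil_card_posRoots_le (d : Fin K → ℕ) (S : Fin K → Matrix (Fin m) (Fin m) ℝ)
    (hS : ∀ l, (S l).IsSymm) (l₀ : Fin K) (hS₀ : IsUnit (S l₀).det) (core : Fin K → Prop) [DecidablePred core]
    (hpsd : ∀ l, l ≠ l₀ → (S l).PosSemidef) (hd : ∀ l, l ≠ l₀ → d l₀ < d l)
    (hP : ∀ w : Fin K → Fin m → ℝ, w l₀ = 0 → (∀ l, w l ≠ 0 → core l) →
        0 ≤ (∑ l, S l *ᵥ w l) ⬝ᵥ ((S l₀)⁻¹ *ᵥ ∑ l, S l *ᵥ w l)) :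
    ((Matrix.det (∑ l, ((Polynomial.X : Polynomial ℝ) ^ d l) • (S l).map Polynomial.C)).roots.toFinset.filter
        (fun t => 0 < t)).card
      ≤ ∑ l ∈ Finset.univ.filter (fun l => l ≠ l₀ ∧ ¬ core l), (S l).rank := by
  refine monotone_pencil_card_posRoots_le d S hS l₀ hS₀ core (fun l hl => Or.inl ⟨hpsd l hl, hd l hl⟩)
    (fun w hw0 hw => hP w hw0 fun l hl => (hw l hl).1) (fun w hw0 hw => ?_)
  -- a vector supported on NSD letters that are also PSD acts by zero
  have hzero : ∀ l, S l *ᵥ w l = 0 := by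
    intro l
    by_cases hl : w l = 0
    · rw [hl, Matrix.mulVec_zero]
    · have hl₀ : l ≠ l₀ := fun h => hl (h ▸ hw0)
      have h1 : (S l).PosSemidef := hpsd l hl₀
      have h2 : (-(S l)).PosSemidef := (hw l hl).2
      have e1 := h1.dotProduct_mulVec_nonneg (w l)
      have e2 := h2.dotProduct_mulVec_nonneg (w l)
      rw [Matrix.neg_mulVec, dotProduct_neg] at e2
      exact (h1.dotProduct_mulVec_zero_iff (w l)).1 (le_antisymm (by linarith) e1)
  simp only [hzero, Finset.sum_const_zero, Matrix.mulVec_zero, dotProduct_zero, le_refl]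

end Pencil

end GramDual

end Summit.ValiantsHypothesis.ValiantsHypothesis.Theorems.LacunarySymmetroidMatrixDescartes
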